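import Literature.NumberTheory.EllipticCurves.Rank1Residual.GVParityLineTypeProofs
import Literature.NumberTheory.EllipticCurves.IsogenyFactorProofs
import Literature.NumberTheory.EllipticCurves.IsogenyDualProofs
import HarnessLib

/-!
# The Greenberg–Vatsal parity type is constant on `ℚ`-isogeny classes (class X1)

HONEST FRAMING (cell `b2b-bsdres`, home `run/shared/lean/b2b/bsd-rank1-residual/`): the cell deletes
COMBINATION-SHAPED residual classes of the rank-`≤ 1` BSD formula from PUBLISHED theorems only and
types the rest; this is not "finishing BSD". `Proofs`-style file (theorems only, no definition, no
named fact), prover x1a gen 3, sequel of `GVParityOrdinaryLineProofs.lean` /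
`GVParityLineTypeProofs.lean`.

The transfer theorems there are stated for isogenies NOT KILLING `E[p]` (e.g. cyclic ones). This
file removes that proviso, so that the statements are about the relation `IsIsogenous` ("some
`ℚ`-isogeny", the census notion: a Cremona class): an isogeny `ψ` with `E[p] ⊆ ker ψ` factors as
`ψ = λ ∘ [p]` (Silverman *AEC* Cor. III.4.11 for `[p]`, tree theorem
`Isogeny.exists_eq_comp_zsmul_of_geomTorsion_le_ker`) with `#ker λ < #ker ψ`, so by induction on
the degree every isogenous pair is joined by an isogeny not killing `E[p]`
(`exists_isogeny_apply_ne_zero`); the reverse isogeny is the dual (`IsIsogenous.symm_of_charZero`).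

* `gvPar_iff_of_isIsogenous_of_not_dvd_frobeniusTrace`, `gvPar_iff_of_isIsogenous_of_anom` —
  **`GVPar W p ↔ GVPar W' p` for `ℚ`-isogenous globally minimal `W, W'` at a good ordinary
  (resp. anomalous Eisenstein) odd prime `p` of both**: the parity type A / B of the census
  `b2b-bsdres-x1a/X1-CENSUS-g2.md` is a function of the `ℚ`-isogeny class, unconditionally.
* `not_gvPar_of_isIsogenous_of_nsmul_eq_zero` — a rational point of order `p` on any isogenous
  (globally minimal, anomalous) curve forces type A.
* `bsdp_of_classX1_of_analyticRank_eq_one_of_KY_OPEN_of_isIsogenous_of_nsmul_eq_zero` — X1 ∧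
  `r_an = 1` ∧ rational `p`-torsion somewhere in the isogeny class ⇒ `BSD(E,p)` from Keller–Yin's
  rank-one display (ANNOUNCED, `hKY_OPEN`) and PUBLISHED named facts only.

## References
* J. H. Silverman, *AEC*, Cor. III.4.11, Thm. III.6.1. [SilvermanAEC2009]
* R. Greenberg, V. Vatsal, Invent. Math. 142 (2000), Thm. (1.3). [GreenbergVatsal2000]
* T. Keller, M. Yin, arXiv:2402.12781v2 (2024), Thm. 4.2.1 (PRE, announced). [KellerYin2024]
-/

set_option autoImplicit false

noncomputable section

open scoped Classical

open WeierstrassCurve Literature.NumberTheory.EllipticCurves Literature.NumberTheory.GaloisRepresentations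
  Literature.NumberTheory.EllipticCurves.ModularForms Field IsDedekindDomain NumberField

namespace Literature.NumberTheory.EllipticCurves.Rank1Residual

variable {W W' : WeierstrassCurve ℚ} [W.IsElliptic] [W'.IsElliptic] {p : ℕ} [Fact p.Prime]

/-! ### Every isogenous pair is joined by an isogeny not killing `E[p]` -/

omit [W'.IsElliptic] in
/-- **An isogeny killing `E[p]` has a factor of smaller degree.** If `ψ : E → E'` over `ℚ` kills
`E[p]`, then `ψ = λ ∘ [p]` (Silverman *AEC* Cor. III.4.11 for the separable isogeny `[p]`; tree
`Isogeny.exists_eq_comp_zsmul_of_geomTorsion_le_ker`) and `#ker λ < #ker ψ`: `[p]` maps `ker ψ`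
onto `ker λ` (`E(ℚ̄)` is divisible) and is not injective there (`E[p] ⊆ ker ψ`, `#E[p] = p² > 1`).
[cite: SilvermanAEC2009, Cor. III.4.11] -/
theorem exists_degree_lt_of_forall_geomTorsion  (ψ : Isogeny W W')
    (hψ : ∀ P ∈ geomTorsion W (p : ℤ), ψ P = 0) :
    ∃ lam : Isogeny W W', lam.degree < ψ.degree := by
  have hp : p.Prime := Fact.out
  have hpQ : ((p : ℤ) : ℚ) ≠ 0 := by exact_mod_cast hp.ne_zero
  have hp0 : (p : ℤ) ≠ 0 := by exact_mod_cast hp.ne_zero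
  obtain ⟨lam, hlam⟩ := Isogeny.exists_eq_comp_zsmul_of_geomTorsion_le_ker hpQ ψ hψ
  refine ⟨lam, ?_⟩
  -- `[p] : ker ψ → ker λ`
  have hmap : ∀ P : ψ.toAddMonoidHom.ker, (p : ℤ) • (P : geomPoints W) ∈ lam.toAddMonoidHom.ker := by
    intro P
    have hP : ψ (P : geomPoints W) = 0 := by
      have := P.2; rwa [AddMonoidHom.mem_ker] at this
    rw [AddMonoidHom.mem_ker, Isogeny.coe_toAddMonoidHom, ← hlam, hP]
  let g : ψ.toAddMonoidHom.ker → lam.toAddMonoidHom.ker := fun P ↦ ⟨(p : ℤ) • (P : geomPoints W), hmap P⟩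
  -- onto
  have hsurj : Function.Surjective g := by
    rintro ⟨Q, hQ⟩
    obtain ⟨P, hP⟩ := zsmul_geomPoints_surjective_holds W hp0 Q
    have hP' : (p : ℤ) • P = Q := hP
    have hPker : P ∈ ψ.toAddMonoidHom.ker := by
      rw [AddMonoidHom.mem_ker] at hQ ⊢
      rw [Isogeny.coe_toAddMonoidHom] at hQ ⊢
      rw [hlam P, hP']
      exact hQ
    exact ⟨⟨P, hPker⟩, Subtype.ext hP'⟩
  -- not injective: a non-zero `p`-torsion point and `0` both go to `0`
  have hE : Nat.card (geomTorsion W (p : ℤ)) = p ^ 2 := natCard_geomTorsion W p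
  haveI : Finite (geomTorsion W (p : ℤ)) :=
    Nat.finite_of_card_ne_zero (by rw [hE]; exact pow_ne_zero 2 hp.ne_zero)
  have hnt : 1 < Nat.card (geomTorsion W (p : ℤ)) := by
    rw [hE]; exact Nat.one_lt_pow two_ne_zero hp.one_lt
  haveI : Nontrivial (geomTorsion W (p : ℤ)) := Finite.one_lt_card_iff_nontrivial.mp hnt
  obtain ⟨⟨T, hT⟩, hT0⟩ := exists_ne (0 : geomTorsion W (p : ℤ))
  have hTker : T ∈ ψ.toAddMonoidHom.ker := by
    rw [AddMonoidHom.mem_ker, Isogeny.coe_toAddMonoidHom]; exact hψ T hT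
  have hninj : ¬ Function.Injective g := by
    intro hinj
    have h1 : g ⟨T, hTker⟩ = g ⟨0, AddSubgroup.zero_mem _⟩ := by
      apply Subtype.ext
      change (p : ℤ) • T = (p : ℤ) • (0 : geomPoints W)
      rw [smul_zero]
      exact (Submodule.mem_torsionBy_iff (p : ℤ) _).mp hT
    have h2 := congrArg Subtype.val (hinj h1)
    exact hT0 (Subtype.ext h2)
  -- count
  have hle : Nat.card lam.toAddMonoidHom.ker ≤ Nat.card ψ.toAddMonoidHom.ker :=
    Nat.card_le_card_of_surjective g hsurj
  refine lt_of_le_of_ne hle fun heq ↦ hninj ?_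
  -- equal cardinalities: a surjection of finite types is a bijection
  exact ((Nat.bijective_iff_surjective_and_card g).mpr ⟨hsurj, heq.symm⟩).1

omit [W'.IsElliptic] in
/-- **Every `ℚ`-isogenous pair of elliptic curves is joined by an isogeny not killing `E[p]`**
(induction on the degree, peeling off factors `[p]` by `exists_degree_lt_of_forall_geomTorsion`).
[cite: SilvermanAEC2009, Cor. III.4.11] -/
theorem exists_isogeny_apply_ne_zero (h : IsIsogenous W W') :
    ∃ f : Isogeny W W', ∃ P : geomPoints W, P ∈ geomTorsion W (p : ℤ) ∧ f P ≠ 0 := by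
  obtain ⟨ψ₀⟩ := h
  -- strong induction on the degree
  suffices H : ∀ (n : ℕ) (ψ : Isogeny W W'), ψ.degree = n →
      ∃ f : Isogeny W W', ∃ P : geomPoints W, P ∈ geomTorsion W (p : ℤ) ∧ f P ≠ 0 from
    H _ ψ₀ rfl
  intro n
  induction n using Nat.strong_induction_on with
  | _ n ih =>
    intro ψ hn
    by_cases hkill : ∀ P ∈ geomTorsion W (p : ℤ), ψ P = 0
    · obtain ⟨lam, hlt⟩ := exists_degree_lt_of_forall_geomTorsion (p := p) ψ hkill
      exact ih lam.degree (hn ▸ hlt) lam rfl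
    · push Not at hkill
      obtain ⟨P, hP, hne⟩ := hkill
      exact ⟨ψ, P, hP, hne⟩

/-! ### `GVPar` is constant on isogeny classes -/

/-- **The Greenberg–Vatsal parity type is a function of the `ℚ`-isogeny class** at a good ordinary
odd prime: for globally minimal `W, W'` over `ℚ`, both with good ordinary reduction at `p ≠ 2`,
`IsIsogenous W W' → (GVPar W p ↔ GVPar W' p)`. [folklore] -/
theorem gvPar_iff_of_isIsogenous_of_not_dvd_frobeniusTrace [W.IsGloballyMinimal]
    [W'.IsGloballyMinimal] (hp2 : p ≠ 2)
    (hgood : W.HasGoodReductionAtPrime p) (hord : ¬ (p : ℤ) ∣ W.frobeniusTrace p)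
    (hgood' : W'.HasGoodReductionAtPrime p) (hord' : ¬ (p : ℤ) ∣ W'.frobeniusTrace p)
    (h : IsIsogenous W W') : GVPar W p ↔ GVPar W' p := by
  obtain ⟨f, P, hP, hf⟩ := exists_isogeny_apply_ne_zero (p := p) h
  obtain ⟨f', P', hP', hf'⟩ := exists_isogeny_apply_ne_zero (p := p) h.symm_of_charZero
  exact gvPar_iff_of_isogeny_of_not_dvd_frobeniusTrace hp2 hgood hord hgood' hord' f ⟨P, hP, hf⟩
    f' ⟨P', hP', hf'⟩

/-- **On class X1 the parity type A / B is a function of the `ℚ`-isogeny class**: for globally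
minimal `W, W'`, `p ≠ 2` an anomalous Eisenstein prime of good reduction of both, and
`IsIsogenous W W'`: `GVPar W p ↔ GVPar W' p`. Census `b2b-bsdres-x1a/X1-CENSUS-g2.md` §2e (flag C,
1524/1524 classes) in the kernel. [folklore] -/
theorem gvPar_iff_of_isIsogenous_of_anom [W.IsGloballyMinimal] [W'.IsGloballyMinimal]
    (hp2 : p ≠ 2) (hW : Anom W p) (hW' : Anom W' p) (h : IsIsogenous W W') :
    GVPar W p ↔ GVPar W' p :=
  gvPar_iff_of_isIsogenous_of_not_dvd_frobeniusTrace hp2 (goodOrd_of_anom W p hW).1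
    (goodOrd_of_anom W p hW).2 (goodOrd_of_anom W' p hW').1 (goodOrd_of_anom W' p hW').2 h

/-- **A rational point of order `p` anywhere in the `ℚ`-isogeny class forces type A** (globally
minimal `W, W'`, `p ≠ 2` anomalous of good reduction for both, `IsIsogenous W W'`, `P ∈ E'(ℚ)` of
order `p`). Census §2d: 1438 of the 1487 type-A classes `N < 2·10⁴`. [folklore] -/
theorem not_gvPar_of_isIsogenous_of_nsmul_eq_zero [W.IsGloballyMinimal] [W'.IsGloballyMinimal]
    (hp2 : p ≠ 2) (hW : Anom W p) (hW' : Anom W' p) (h : IsIsogenous W W')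
    (P : W'.toAffine.Point) (hP0 : P ≠ 0) (hpP : p • P = 0) : ¬ GVPar W p := fun hG ↦
  not_gvPar_of_anom_of_nsmul_eq_zero W' hp2 hW' P hP0 hpP
    ((gvPar_iff_of_isIsogenous_of_anom hp2 hW hW' h).mp hG)

/-! ### Class X1 at analytic rank one: Keller–Yin alone, by a torsion point in the class -/

variable (W p) in
/-- **X1 ∧ `r_an = 1` ∧ a rational point of order `p` on an isogenous curve ⇒ `BSD(E,p)` from
Keller–Yin's rank-one display alone** (`W'` globally minimal, anomalous at `p`, `IsIsogenous W W'`;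
type A by `not_gvPar_of_isIsogenous_of_nsmul_eq_zero`, then gen 1's
`bsdp_of_classX1_typeA_of_analyticRank_eq_one_of_KY_OPEN`). Inputs: `hKY_OPEN` (ANNOUNCED,
arXiv:2402.12781v2 Thm. 4.2.1) and the PUBLISHED named facts GV 2000 Thm 1.3, Greenberg 1999
Thm 4.1, modularity, Hoffstein–Luo, Gross–Zagier I.7.3, GZK. [cite: KellerYin2024, Thm. 4.2.1 (p. 22)] -/
theorem bsdp_of_classX1_of_analyticRank_eq_one_of_KY_OPEN_of_isIsogenous_of_nsmul_eq_zero
    (hGV : GreenbergVatsal2000.thm13_charIdeal_eq_of_gvPar) (hGr : greenberg_charValue_rankZero)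
    (hmodP : nonempty_modularParametrizationData) (hmod : exists_isNewformOf)
    (hHL : HoffsteinLuo1997_exists_twist_L_one_ne_zero) (hGZ : GrossZagier1986_thm_I_7_3)
    (hGZK : rank_eq_analyticRank_of_analyticRank_le_one)
    [W.IsGloballyMinimal] [W'.IsGloballyMinimal] (hX1 : ClassX1 W p) (hr : W.analyticRank = 1)
    (hW' : Anom W' p) (h : IsIsogenous W W')
    (P : W'.toAffine.Point) (hP0 : P ≠ 0) (hpP : p • P = 0)
    (hKY_OPEN : ∀ (W' : WeierstrassCurve ℚ) [W'.IsElliptic] [W'.IsGloballyMinimal] (p' : ℕ)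
        [Fact p'.Prime], p' ≠ 2 → W'.HasGoodReductionAtPrime p' → ¬ W'.HasIrreducibleModPGaloisRep p' →
        W'.analyticRank = 1 →
      ∀ (K : Type) [Field K] [NumberField K], IsImaginaryQuadratic K →
        Odd (NumberField.discr K) → NumberField.discr K < -4 →
        SatisfiesHeegnerHypothesis (W'.conductorNorm ℤ) K → SatisfiesHeegnerHypothesis p' K →
        (W'.quadraticTwist (NumberField.discr K : ℚ)).entireLFunction 1 ≠ 0 →
      ∀ (Wd : WeierstrassCurve ℚ) [Wd.IsElliptic] [Wd.IsGloballyMinimal],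
        (∃ C : VariableChange ℚ, C • Wd = W'.quadraticTwist (NumberField.discr K : ℚ)) →
      ∀ (q qd : ℚ), W'.leadingLCoeff / ((W'.realPeriodRat * W'.regulator : ℝ) : ℂ) = (q : ℂ) →
        Wd.entireLFunction 1 / (Wd.realPeriodRat : ℂ) = (qd : ℂ) →
        padicValRat p' q - ((padicValNat p' W'.shaOrder : ℤ) + padicValNat p' W'.tamagawaProduct -
            2 * padicValNat p' W'.torsionOrder) =
          -(padicValRat p' qd - ((padicValNat p' Wd.shaOrder : ℤ) + padicValNat p' Wd.tamagawaProduct -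
            2 * padicValNat p' Wd.torsionOrder))) :
    BSDp W p :=
  bsdp_of_classX1_typeA_of_analyticRank_eq_one_of_KY_OPEN hGV hGr hmodP hmod hHL hGZ hGZK W p hX1
    (not_gvPar_of_isIsogenous_of_nsmul_eq_zero hX1.1.ne' hX1.2.2.2.1 hW' h P hP0 hpP) hr hKY_OPEN

end Literature.NumberTheory.EllipticCurves.Rank1Residual

end
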